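import Summits.QuantumFields.YangMills.Theorems.BalabanUVNodesN15KingModelBoxShiftedHalfGrids
import HarnessLib

/-!
# BalabanUVNodes ∕ N15 — THE KING-MODEL RUNG (PART Ϟ-g): FREE vs PERIODIC BOUNDARY CONDITIONS AT FINITE VOLUME — THE SURFACE-TO-VOLUME RATE
# `| |T̂(2n)|⁻¹·ln det(c(−Δ)+m²)_{Πℤ∕2n_μ} − |Ω|⁻¹·ln det(c(−Δ_free)+m²)_Ω | ≤ 2(|ln m²| + |ln(m²+4c(d+1))|)·Σ_μ 1∕n_μ`
# (Track A, DAG node N15 = NE2; FAN-OUT v1.1 §N15 s3 «KING-MODEL RUNG»; King p.670 l.8–13 «free boundary conditions»; count-neutral)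

HONEST FRAMING.  Count-neutral (cell `pub-ymgap`, seat `pub-ymgap-dag-n15-e` g41; `--supports stmt-QuantumFields-27366 --as helper` = K3⁸).
TEMPLATE LITERATURE: C. King, Commun. Math. Phys. **102** (1986) 649–677 [King1986]: (3.89)–(3.93) pp.668–669 (the normalisations are extensive with volume-uniform
per-site control), §4 p.670 l.8–13 (free boundary conditions on `Ω`), (4.4) p.670.  Part Ϟ-e wrote the free energy of the DOUBLED torus as the sum of the `2^{d+1}` SHIFTED
half-grid sums `boxLogSymSum S` (exact) and the free-boundary free energy of `Ω` as `boxLogSymSum ∅`; part Ϟ-f identified the common thermodynamic limit.  THIS FILE quantifies the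
difference at FINITE volume: shifting the half grid in ONE direction `μ` changes the sum by a TELESCOPING boundary term (one face of `Ω`), at most `2B·|Ω|∕n_μ` with
`B = |ln m²| + |ln(m²+4c(d+1))|` (Ε-m's symbol bound); hence `|boxLogSymSum S − boxLogSymSum ∅| ≤ 2B|Ω|Σ_{μ∈S}1∕n_μ` and the periodic (doubled-torus) and free-boundary free energy
DENSITIES differ by at most `2B·Σ_μ 1∕n_μ` — a surface-to-volume rate.
§1 def **`boxShiftPt n S s`** (the shifted half-grid point `(π((s_ν)+[ν∈S])∕n_ν)_ν`), `boxLogSymSum_eq_sum_boxShiftPt`, `boxShiftPt_insertNth_of_not_mem` ∕ `boxShiftPt_insertNth_insert` (the point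
of `insertNth μ x r` in the two shifts `S`, `insert μ S` as `Fin.insertNth` of the `μ`-coordinate `πx∕n_μ` resp. `π(x+1)∕n_μ`), `sum_kingBox_eq_sum_insertNth` (Fubini: a sum over `Ω`
is a sum over the `μ`-coordinate and the rest), ★★ **`abs_boxLogSymSum_insert_sub_le`** (`|boxLogSymSum (insert μ S) − boxLogSymSum S| ≤ 2B·Π_{ν≠μ}n_ν`, `μ ∉ S`:
TELESCOPING IN THE DIRECTION `μ`), `prod_cast_eq_mul_prod_succAbove`.
§2 ★★ **`abs_boxLogSymSum_sub_empty_le`** (`|boxLogSymSum S − boxLogSymSum ∅| ≤ 2B·(Π_νn_ν)·Σ_{μ∈S}(n_μ)⁻¹`, induction on `S`).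
§3 ★★★ **`abs_log_det_lapF_dbl_div_card_sub_box_le`** (`| |T̂(2n)|⁻¹ln det(lapF(2n)) − |Ω|⁻¹ln det(boxOp n) | ≤ 2B·Σ_μ(n_μ)⁻¹`: PERIODIC vs FREE boundary conditions at finite
volume), ★★ **`abs_log_gaussNorm_lapF_dbl_div_card_sub_box_le`** (the same for the Gaussian normalisations per site, constant `B`), ★★ `tendsto_log_det_lapF_dbl_sub_box`
(the difference `→ 0` along boxes with all sides `→ ∞`, directly from the rate).

PRIOR TREE ART (named, USED not restated): Ϟ-e (`boxLogSymSum`, `sum_log_lapSym_dblTorus_eq`, `log_det_boxOp_eq_boxLogSymSum`, `card_kingBox`), Ϟ-c (`log_gaussNorm_boxOp`,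
`log_det_boxOp`), Ε-k∕Ε-p (`log_det_lapF`, `log_gaussNorm_lapF`), Ε-m (`kingLogSym`, `abs_kingLogSym_le`), Ν-b (`card_dblTorus_eq`), Mathlib (`Fin.insertNthEquiv`,
`Fin.insertNth_apply_same∕succAbove`, `Fin.prod_univ_succAbove`, `Finset.sum_range_sub`).  NOT Bałaban's covariant objects; NOT a node discharge (N15 is booked through
n15-a's knit, untouched); nothing continuum-YM ∕ `ℝ⁴` ∕ OS ∕ Clay.  0 `sorry`; 1 plumbing `def` (`boxShiftPt`).

HONEST SCOPE.  King's `A = 0` free symbol (`c ≥ 0`, `m² > 0`), every box `Ω = Π_μ{0,…,n_μ−1}` (all sides ≥ 1); the comparison is between `Ω` with free boundary conditions and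
the DOUBLED torus `Πℤ∕2n_μ` (the torus the images live on) — not the torus `Πℤ∕n_μ` of the same volume (both densities converge to `kingFreeEnergyInf`, parts Ε-m∕Ϟ-f, but no
rate between them is claimed here).  Locators: [King1986] (3.89)–(3.93) pp.668–669, §4 p.670 l.8–13, (4.4) p.670.
-/

noncomputable section

open scoped BigOperators
open Finset

namespace Summit.QuantumFields.YangMills.BalabanUVNodes.N15KingModelRung.TorusSpectral

open Literature.MathematicalPhysics.QuantumFieldTheory.Balaban1983to89.B5Prop11Plancherel (Tor)
open Literature.MathematicalPhysics.QuantumFieldTheory.King1986.Torus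
open Summit.QuantumFields.YangMills.BalabanUVNodes.N15KingModelRung.FreeField (gaussNorm)

variable {d : ℕ}

/-! ## §1 Shifting the half grid in one direction costs one boundary face -/

section OneDirection

variable (n : Fin (d + 1) → ℕ) (c m2 : ℝ)

/-- the shifted half-grid point `(π((s_ν) + [ν∈S])∕n_ν)_ν` of `s ∈ Ω`. [folklore] -/
def boxShiftPt (S : Finset (Fin (d + 1))) (s : KingBox n) : Fin (d + 1) → ℝ := fun ν => Real.pi * ((s ν).val + if ν ∈ S then (1 : ℝ) else 0) / n ν

/-- `boxLogSymSum S = Σ_s kingLogSym(boxShiftPt S s)`. [folklore] -/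
theorem boxLogSymSum_eq_sum_boxShiftPt (S : Finset (Fin (d + 1))) : boxLogSymSum n c m2 S = ∑ s : KingBox n, kingLogSym c m2 (boxShiftPt n S s) := rfl

variable (μ : Fin (d + 1))

/-- the point of `insertNth μ x r` under the shift `S ∌ μ`: `μ`-coordinate `πx∕n_μ`, the other coordinates those of `r` shifted by `S`. [folklore] -/
theorem boxShiftPt_insertNth_of_not_mem {S : Finset (Fin (d + 1))} (hμ : μ ∉ S) (x : Fin (n μ)) (r : ∀ i : Fin d, Fin (n (μ.succAbove i))) :
    boxShiftPt n S (Fin.insertNth μ x r)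
      = Fin.insertNth μ (Real.pi * (x.val : ℝ) / n μ) (fun i => Real.pi * ((r i).val + if μ.succAbove i ∈ S then (1 : ℝ) else 0) / n (μ.succAbove i)) := by
  refine (Fin.eq_insertNth_iff).mpr ⟨?_, ?_⟩
  · simp only [boxShiftPt, Fin.insertNth_apply_same, if_neg hμ, add_zero]
  · funext i
    simp only [Fin.removeNth, boxShiftPt, Fin.insertNth_apply_succAbove]

/-- the point of `insertNth μ x r` under the shift `insert μ S`: `μ`-coordinate `π(x+1)∕n_μ`, the other coordinates as for `S`. [folklore] -/
theorem boxShiftPt_insertNth_insert {S : Finset (Fin (d + 1))} (x : Fin (n μ)) (r : ∀ i : Fin d, Fin (n (μ.succAbove i))) :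
    boxShiftPt n (insert μ S) (Fin.insertNth μ x r)
      = Fin.insertNth μ (Real.pi * ((x.val : ℝ) + 1) / n μ) (fun i => Real.pi * ((r i).val + if μ.succAbove i ∈ S then (1 : ℝ) else 0) / n (μ.succAbove i)) := by
  refine (Fin.eq_insertNth_iff).mpr ⟨?_, ?_⟩
  · simp only [boxShiftPt, Fin.insertNth_apply_same, Finset.mem_insert_self, if_true]
  · funext i
    have hne : μ.succAbove i ≠ μ := Fin.succAbove_ne μ i
    simp only [Fin.removeNth, boxShiftPt, Fin.insertNth_apply_succAbove, Finset.mem_insert, hne, false_or]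

omit c m2 in
/-- FUBINI ON `Ω`: a sum over `Ω = Π_νFin n_ν` is a sum over the `μ`-coordinate and the remaining ones (`Fin.insertNthEquiv`). [folklore] -/
theorem sum_kingBox_eq_sum_insertNth (F : KingBox n → ℝ) :
    ∑ s : KingBox n, F s = ∑ r : (∀ i : Fin d, Fin (n (μ.succAbove i))), ∑ x : Fin (n μ), F (Fin.insertNth μ x r) := by
  rw [← Fintype.sum_equiv (Fin.insertNthEquiv (fun ν => Fin (n ν)) μ) (fun p => F (Fin.insertNth μ p.1 p.2)) F (fun p => rfl), Fintype.sum_prod_type_right]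

variable {c m2}

/-- ★★ **SHIFTING THE HALF GRID IN ONE DIRECTION COSTS ONE BOUNDARY FACE**: for `μ ∉ S`, `|boxLogSymSum (insert μ S) − boxLogSymSum S| ≤ 2B·Π_{i}n_{μ.succAbove i}`
(`B = |ln m²| + |ln(m²+4c(d+1))|`; the `μ`-sums telescope to `g(n_μ) − g(0)`). [cite: King1986, (3.89)–(3.93) pp.668–669, §4 p.670] -/
theorem abs_boxLogSymSum_insert_sub_le (hc : 0 ≤ c) (hm : 0 < m2) {S : Finset (Fin (d + 1))} (hμ : μ ∉ S) :
    |boxLogSymSum n c m2 (insert μ S) - boxLogSymSum n c m2 S|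
      ≤ 2 * (|Real.log m2| + |Real.log (m2 + 4 * c * (d + 1))|) * ∏ i : Fin d, (n (μ.succAbove i) : ℝ) := by
  set B : ℝ := |Real.log m2| + |Real.log (m2 + 4 * c * (d + 1))| with hB
  -- the telescoping function for fixed remaining coordinates `r`
  set g : (∀ i : Fin d, Fin (n (μ.succAbove i))) → ℕ → ℝ := fun r t =>
    kingLogSym c m2 (Fin.insertNth μ (Real.pi * (t : ℝ) / n μ) (fun i => Real.pi * ((r i).val + if μ.succAbove i ∈ S then (1 : ℝ) else 0) / n (μ.succAbove i))) with hg
  have hdiff : boxLogSymSum n c m2 (insert μ S) - boxLogSymSum n c m2 S = ∑ r : (∀ i : Fin d, Fin (n (μ.succAbove i))), (g r (n μ) - g r 0) := by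
    rw [boxLogSymSum_eq_sum_boxShiftPt, boxLogSymSum_eq_sum_boxShiftPt, sum_kingBox_eq_sum_insertNth n μ, sum_kingBox_eq_sum_insertNth n μ, ← Finset.sum_sub_distrib]
    refine Finset.sum_congr rfl fun r _ => ?_
    -- telescoping over the `μ`-coordinate (the tree's `sum_fin_telescope` lives under `BalabanUV/`, not importable here; inlined)
    have htel : ∑ x : Fin (n μ), (g r (x.val + 1) - g r x.val) = g r (n μ) - g r 0 := by
      rw [Fin.sum_univ_eq_sum_range (fun t => g r (t + 1) - g r t) (n μ), Finset.sum_range_sub]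
    rw [← Finset.sum_sub_distrib, ← htel]
    refine Finset.sum_congr rfl fun x _ => ?_
    rw [boxShiftPt_insertNth_insert, boxShiftPt_insertNth_of_not_mem n μ hμ, hg]
    push_cast
    rfl
  rw [hdiff]
  refine (Finset.abs_sum_le_sum_abs _ _).trans ?_
  have hterm : ∀ r : (∀ i : Fin d, Fin (n (μ.succAbove i))), |g r (n μ) - g r 0| ≤ 2 * B := by
    intro r
    have h1 : |g r (n μ)| ≤ B := abs_kingLogSym_le hc hm _
    have h2 : |g r 0| ≤ B := abs_kingLogSym_le hc hm _
    calc |g r (n μ) - g r 0| ≤ |g r (n μ)| + |g r 0| := abs_sub _ _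
      _ ≤ 2 * B := by linarith
  calc ∑ r : (∀ i : Fin d, Fin (n (μ.succAbove i))), |g r (n μ) - g r 0| ≤ ∑ _r : (∀ i : Fin d, Fin (n (μ.succAbove i))), 2 * B := Finset.sum_le_sum fun r _ => hterm r
    _ = 2 * B * ∏ i : Fin d, (n (μ.succAbove i) : ℝ) := by
        rw [Finset.sum_const, Finset.card_univ, Fintype.card_pi, nsmul_eq_mul]
        simp only [Fintype.card_fin]
        push_cast
        ring

omit c m2 in
/-- `Π_νn_ν = n_μ·Π_i n_{μ.succAbove i}` (real cast). [folklore] -/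
theorem prod_cast_eq_mul_prod_succAbove : (∏ ν, (n ν : ℝ)) = (n μ : ℝ) * ∏ i : Fin d, (n (μ.succAbove i) : ℝ) :=
  Fin.prod_univ_succAbove (fun ν => (n ν : ℝ)) μ

end OneDirection

/-! ## §2 All shifts: induction over the shifted directions -/

section AllShifts

variable (n : Fin (d + 1) → ℕ) [hn : ∀ μ, NeZero (n μ)] {c m2 : ℝ}

/-- ★★ `|boxLogSymSum S − boxLogSymSum ∅| ≤ 2B·(Π_νn_ν)·Σ_{μ∈S}(n_μ)⁻¹` (one face per shifted direction). [cite: King1986, (3.89)–(3.93) pp.668–669, §4 p.670] -/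
theorem abs_boxLogSymSum_sub_empty_le (hc : 0 ≤ c) (hm : 0 < m2) (S : Finset (Fin (d + 1))) :
    |boxLogSymSum n c m2 S - boxLogSymSum n c m2 ∅|
      ≤ 2 * (|Real.log m2| + |Real.log (m2 + 4 * c * (d + 1))|) * (∏ ν, (n ν : ℝ)) * ∑ μ ∈ S, ((n μ : ℝ))⁻¹ := by
  set B : ℝ := |Real.log m2| + |Real.log (m2 + 4 * c * (d + 1))| with hB
  have hB0 : 0 ≤ B := by positivity
  induction S using Finset.induction_on with
  | empty => simp
  | insert μ S hμ ih =>
    have hnμ : (0 : ℝ) < n μ := by exact_mod_cast NeZero.pos (n μ)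
    have hface := abs_boxLogSymSum_insert_sub_le n μ hc hm hμ
    rw [← hB] at hface
    have hprod : (∏ ν, (n ν : ℝ)) * ((n μ : ℝ))⁻¹ = ∏ i : Fin d, (n (μ.succAbove i) : ℝ) := by
      rw [prod_cast_eq_mul_prod_succAbove n μ, mul_comm, ← mul_assoc, inv_mul_cancel₀ hnμ.ne', one_mul]
    rw [Finset.sum_insert hμ, mul_add]
    calc |boxLogSymSum n c m2 (insert μ S) - boxLogSymSum n c m2 ∅|
        ≤ |boxLogSymSum n c m2 (insert μ S) - boxLogSymSum n c m2 S| + |boxLogSymSum n c m2 S - boxLogSymSum n c m2 ∅| := abs_sub_le _ _ _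
      _ ≤ 2 * B * ∏ i : Fin d, (n (μ.succAbove i) : ℝ) + 2 * B * (∏ ν, (n ν : ℝ)) * ∑ μ ∈ S, ((n μ : ℝ))⁻¹ := add_le_add hface ih
      _ = _ := by rw [← hprod]; ring

end AllShifts

/-! ## §3 Periodic (doubled torus) versus free boundary conditions at finite volume -/

section Comparison

variable (n : Fin (d + 1) → ℕ) [hn : ∀ μ, NeZero (n μ)] {c m2 : ℝ}

/-- ★★★ **FREE vs PERIODIC BOUNDARY CONDITIONS AT FINITE VOLUME — THE SURFACE-TO-VOLUME RATE**: for `c ≥ 0`, `m² > 0` and every box `Ω = Π_μ{0,…,n_μ−1}`,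
`| |T̂(2n)|⁻¹·ln det(c(−Δ)+m²)_{Πℤ∕2n_μ} − |Ω|⁻¹·ln det(c(−Δ_free)+m²)_Ω | ≤ 2(|ln m²| + |ln(m²+4c(d+1))|)·Σ_μ(n_μ)⁻¹`. [cite: King1986, (3.89)–(3.93) pp.668–669, §4 p.670 l.8–13,
(4.4) p.670] -/
theorem abs_log_det_lapF_dbl_div_card_sub_box_le (hc : 0 ≤ c) (hm : 0 < m2) :
    |(Fintype.card (Tor (dblPer n)) : ℝ)⁻¹ * Real.log (lapF (dblPer n) c m2).det - (Fintype.card (KingBox n) : ℝ)⁻¹ * Real.log (boxOp n c m2).det|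
      ≤ 2 * (|Real.log m2| + |Real.log (m2 + 4 * c * (d + 1))|) * ∑ μ, ((n μ : ℝ))⁻¹ := by
  set B : ℝ := |Real.log m2| + |Real.log (m2 + 4 * c * (d + 1))| with hB
  have hB0 : 0 ≤ B := by positivity
  have hP : (0 : ℝ) < ∏ ν, (n ν : ℝ) := Finset.prod_pos fun ν _ => by exact_mod_cast NeZero.pos (n ν)
  have h2 : (0 : ℝ) < 2 ^ (d + 1) := by positivity
  -- rewrite both densities through the shifted half-grid sums
  have hT : (Fintype.card (Tor (dblPer n)) : ℝ)⁻¹ * Real.log (lapF (dblPer n) c m2).det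
      = ((2 : ℝ) ^ (d + 1))⁻¹ * (∏ ν, (n ν : ℝ))⁻¹ * ∑ S : Finset (Fin (d + 1)), boxLogSymSum n c m2 S := by
    rw [log_det_lapF (dblPer n) hc hm, sum_log_lapSym_dblTorus_eq n c m2, card_dblTorus_eq n, card_kingBox n]
    push_cast
    rw [mul_inv]
  have hΩ : (Fintype.card (KingBox n) : ℝ)⁻¹ * Real.log (boxOp n c m2).det
      = ((2 : ℝ) ^ (d + 1))⁻¹ * (∏ ν, (n ν : ℝ))⁻¹ * ∑ _S : Finset (Fin (d + 1)), boxLogSymSum n c m2 ∅ := by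
    rw [log_det_boxOp_eq_boxLogSymSum n hc hm, card_kingBox n, Finset.sum_const, Finset.card_univ, Fintype.card_finset, Fintype.card_fin, nsmul_eq_mul]
    push_cast
    rw [mul_mul_mul_comm, inv_mul_cancel₀ h2.ne', one_mul]
  rw [hT, hΩ, ← mul_sub, ← Finset.sum_sub_distrib, abs_mul, abs_of_pos (by positivity : (0 : ℝ) < ((2 : ℝ) ^ (d + 1))⁻¹ * (∏ ν, (n ν : ℝ))⁻¹)]
  have hsum : |∑ S : Finset (Fin (d + 1)), (boxLogSymSum n c m2 S - boxLogSymSum n c m2 ∅)|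
      ≤ ∑ _S : Finset (Fin (d + 1)), 2 * B * (∏ ν, (n ν : ℝ)) * ∑ μ, ((n μ : ℝ))⁻¹ := by
    refine (Finset.abs_sum_le_sum_abs _ _).trans (Finset.sum_le_sum fun S _ => ?_)
    refine (abs_boxLogSymSum_sub_empty_le n hc hm S).trans ?_
    rw [← hB]
    refine mul_le_mul_of_nonneg_left ?_ (by positivity)
    exact Finset.sum_le_univ_sum_of_nonneg fun μ => by positivity
  rw [Finset.sum_const, Finset.card_univ, Fintype.card_finset, Fintype.card_fin, nsmul_eq_mul] at hsum
  push_cast at hsum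
  calc ((2 : ℝ) ^ (d + 1))⁻¹ * (∏ ν, (n ν : ℝ))⁻¹ * |∑ S : Finset (Fin (d + 1)), (boxLogSymSum n c m2 S - boxLogSymSum n c m2 ∅)|
      ≤ ((2 : ℝ) ^ (d + 1))⁻¹ * (∏ ν, (n ν : ℝ))⁻¹ * (2 ^ (d + 1) * (2 * B * (∏ ν, (n ν : ℝ)) * ∑ μ, ((n μ : ℝ))⁻¹)) :=
        mul_le_mul_of_nonneg_left hsum (by positivity)
    _ = 2 * B * ∑ μ, ((n μ : ℝ))⁻¹ := by
        field_simp

/-- ★★ **THE SAME FOR THE GAUSSIAN NORMALISATIONS PER SITE**: `| |T̂(2n)|⁻¹ln 𝒩((c(−Δ)+m²)_{Πℤ∕2n}) − |Ω|⁻¹ln 𝒩((c(−Δ_free)+m²)_Ω) | ≤ (|ln m²|+|ln(m²+4c(d+1))|)·Σ_μ(n_μ)⁻¹`.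
[cite: King1986, (3.89)–(3.93) pp.668–669, (2.6) p.652, §4 p.670] -/
theorem abs_log_gaussNorm_lapF_dbl_div_card_sub_box_le (hc : 0 ≤ c) (hm : 0 < m2) :
    |(Fintype.card (Tor (dblPer n)) : ℝ)⁻¹ * Real.log (gaussNorm (lapF (dblPer n) c m2)) - (Fintype.card (KingBox n) : ℝ)⁻¹ * Real.log (gaussNorm (boxOp n c m2))|
      ≤ (|Real.log m2| + |Real.log (m2 + 4 * c * (d + 1))|) * ∑ μ, ((n μ : ℝ))⁻¹ := by
  have hT0 : (Fintype.card (Tor (dblPer n)) : ℝ) ≠ 0 := by exact_mod_cast Fintype.card_ne_zero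
  have hΩ0 : (Fintype.card (KingBox n) : ℝ) ≠ 0 := by exact_mod_cast Fintype.card_ne_zero
  have h := abs_log_det_lapF_dbl_div_card_sub_box_le n hc hm
  rw [log_gaussNorm_lapF (dblPer n) hc hm, log_gaussNorm_boxOp n hc hm, ← log_det_lapF (dblPer n) hc hm, ← log_det_boxOp n hc hm]
  have e : (Fintype.card (Tor (dblPer n)) : ℝ)⁻¹ * ((Fintype.card (Tor (dblPer n)) : ℝ) / 2 * Real.log (2 * Real.pi) - 1 / 2 * Real.log (lapF (dblPer n) c m2).det)
      - (Fintype.card (KingBox n) : ℝ)⁻¹ * ((Fintype.card (KingBox n) : ℝ) / 2 * Real.log (2 * Real.pi) - 1 / 2 * Real.log (boxOp n c m2).det)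
      = -(1 / 2) * ((Fintype.card (Tor (dblPer n)) : ℝ)⁻¹ * Real.log (lapF (dblPer n) c m2).det - (Fintype.card (KingBox n) : ℝ)⁻¹ * Real.log (boxOp n c m2).det) := by
    field_simp
    ring
  rw [e, abs_mul, abs_neg, abs_of_pos (by norm_num : (0 : ℝ) < 1 / 2)]
  calc _ ≤ 1 / 2 * (2 * (|Real.log m2| + |Real.log (m2 + 4 * c * (d + 1))|) * ∑ μ, ((n μ : ℝ))⁻¹) := mul_le_mul_of_nonneg_left h (by norm_num)
    _ = _ := by ring

end Comparison

/-! ## §4 The difference vanishes along growing boxes -/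

section Vanishing

variable {c m2 : ℝ}

/-- ★★ along boxes with all sides `→ ∞` the periodic and free-boundary free energy densities have the SAME limit, with the explicit rate `2B·Σ_μ 1∕n_{j,μ}`.
[cite: King1986, (3.89)–(3.93) pp.668–669, §4 p.670] -/
theorem tendsto_log_det_lapF_dbl_sub_box (hc : 0 ≤ c) (hm : 0 < m2) (nseq : ℕ → Fin (d + 1) → ℕ) (hpos : ∀ j ν, 0 < nseq j ν)
    (hlim : ∀ ν, Filter.Tendsto (fun j => (nseq j ν : ℝ)) Filter.atTop Filter.atTop) :
    Filter.Tendsto (fun j => haveI : ∀ ν, NeZero (nseq j ν) := fun ν => ⟨(hpos j ν).ne'⟩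
      (Fintype.card (Tor (dblPer (nseq j))) : ℝ)⁻¹ * Real.log (lapF (dblPer (nseq j)) c m2).det
        - (Fintype.card (KingBox (nseq j)) : ℝ)⁻¹ * Real.log (boxOp (nseq j) c m2).det) Filter.atTop (nhds 0) := by
  have hrate : Filter.Tendsto (fun j => 2 * (|Real.log m2| + |Real.log (m2 + 4 * c * (d + 1))|) * ∑ μ, ((nseq j μ : ℝ))⁻¹) Filter.atTop (nhds 0) := by
    have h0 : Filter.Tendsto (fun j => ∑ μ, ((nseq j μ : ℝ))⁻¹) Filter.atTop (nhds 0) := by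
      have := tendsto_finsetSum (Finset.univ : Finset (Fin (d + 1))) fun μ _ => (hlim μ).inv_tendsto_atTop
      simpa using this
    simpa using h0.const_mul (2 * (|Real.log m2| + |Real.log (m2 + 4 * c * (d + 1))|))
  refine squeeze_zero_norm (fun j => ?_) hrate
  haveI : ∀ ν, NeZero (nseq j ν) := fun ν => ⟨(hpos j ν).ne'⟩
  rw [Real.norm_eq_abs]
  exact abs_log_det_lapF_dbl_div_card_sub_box_le (nseq j) hc hm

end Vanishing

end Summit.QuantumFields.YangMills.BalabanUVNodes.N15KingModelRung.TorusSpectral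

end
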